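import Summits.ResolutionOfSingularities.ResolutionOfSingularities.Theses.Valuative
import Summits.ResolutionOfSingularities.ResolutionOfSingularities.Theorems.ValuativeTorsorToLurelFfiniteTower
import Summits.ResolutionOfSingularities.ResolutionOfSingularities.Theorems.ValuativeTorsorToLurelFfiniteFrobenius
import Summits.ResolutionOfSingularities.ResolutionOfSingularities.Theorems.ValuativeTorsorToLurelFfiniteGenerators
import Summits.ResolutionOfSingularities.ResolutionOfSingularities.Theorems.ValuativeTorsorToLurelFfiniteAbsorb
import Summits.ResolutionOfSingularities.ResolutionOfSingularities.Theorems.ValuativeTorsorToLurel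
import Literature.AlgebraicGeometry.Resolution.LocalUniformization
import Literature.AlgebraicGeometry.Resolution.ValuedFunctionFields
import Mathlib.FieldTheory.PurelyInseparable.Exponent
import Mathlib.RingTheory.RegularLocalRing.Defs
import HarnessLib

/-!
# `PalterationThesis` (crux stmt-ResolutionOfSingularities-0552), line `Sketch` rev. c5:
# over a perfect field, route Valuative's torsor crux `LuAlphaPTorsor` (stmt-0641) implies `RRLU1_K`

Helper file of the line lead (c5) for the skeleton `Cruxes/PalterationThesis/Lines/Sketch.lean`
(`--supports stmt-ResolutionOfSingularities-0552`; it does not close the item).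

The research residue of the line over a perfect field `K` of characteristic `p` is `RRLU1_K`
(rev. c3; its zero-dimensional non-Abhyankar core in rev. c4): for `K ⊆ F ⊆ L` with `F/K`
finitely generated, `L = F(y)` purely inseparable with `y ^ p ∈ F`, a finitely generated
REGULAR `K`-subalgebra `B ⊆ L` with `Frac B = L` and a valuation ring `O ⊇ B` of `L`, the trace
`O ∩ F` is locally uniformizable over `K` — local uniformization DESCENDS one radicial step below a
regular affine model. Route `Valuative`'s crux `LuAlphaPTorsor` (stmt-0641, Temkin 2013,
Rem. 1.3.5 (ii)–(iii)) is the ASCENDING statement: local uniformization of `α_p`-torsors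
`t ^ p = a` over bases regular at the centre, relative form (`A ⊇ A₀ ∪ {t}`), for every ground
field of characteristic `p`.

* `rrLU1At_of_luAlphaPTorsorAt` — over a PERFECT `K`, the torsor crux at the prime `p` implies
  `RRLU1_K`. Proof (Temkin 2013, Rem. 1.3.5 (i)–(ii), with the regular chart GIVEN instead of
  produced by Thm. 1.3.2): with `pⁿ ≥` the exponent of `L/F`, the Frobenius `ρ x = x^{pⁿ} : L → F`
  maps `B` isomorphically onto `A₀ = ρ(B) ⊆ O ∩ F`, a finitely generated `K^{pⁿ}`-algebra regular
  at the centre of `O ∩ F = ρ(O)` with `F^{pⁿ} ⊆ Frac A₀`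
  (`ValuativeTorsorToLurelFfiniteFrobenius`); finitely many `g ∈ O ∩ F` generate `F` over
  `K^{pⁿ}` (`K` perfect is `F`-finite; `ValuativeTorsorToLurelFfiniteGenerators`), each with
  `g^{pⁿ} ∈ Frac A₀`, and the torsor tower (`torsor_roots`, one application of the crux per
  `p`-th root, `ValuativeTorsorToLurelFfiniteTower`) yields a finitely generated
  `K^{pⁿ}`-algebra `A₁ ⊇ A₀` inside `O ∩ F`, regular at the centre, with `Frac A₁ = F`; finally
  `A := K[A₁]` is regular at the centre by absorption (`isRegularLocalRing_centre_of_pow_mem`;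
  over a perfect `K` in fact `A = A₁`).
* `rrLU1At_of_luAlphaPTorsor`, `rrLU1CoreAt_of_luAlphaPTorsor` — hence the route item
  `Valuative.LuAlphaPTorsor` BY NAME implies `RRLU1_K` and its rev. c4 core over every perfect
  field `K` of every prime characteristic: the line's research residue is (implied by) an
  EXISTING crux item of route `Valuative`.

Sources: M. Temkin, *Inseparable local uniformization*, J. Algebra 373 (2013) 65–119
(arXiv:0804.1554v3), Rem. 1.3.5 (i)–(ii), p. 4.
-/

set_option linter.dupNamespace false -- mandated namespace of this single-conjunct summit

noncomputable section

open IsLocalRing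
open Literature.AlgebraicGeometry.Resolution
open Summit.ResolutionOfSingularities.ResolutionOfSingularities.Theorems

namespace Summit.ResolutionOfSingularities.ResolutionOfSingularities.Theorems.PalterationThesis.PerfectAtoms

/-- **A height-one purely inseparable extension generated by one element is finite.** If
`y ^ p ∈ F` for a prime `p` and `L = F(y)`, then `L/F` is finite-dimensional. [folklore] -/
theorem finiteDimensional_of_adjoin_pth_root_eq_top {F L : Type} [Field F] [Field L]
    [Algebra F L] {p : ℕ} (hp : p.Prime) {y : L} (hy : y ^ p ∈ (algebraMap F L).range)
    (hytop : IntermediateField.adjoin F {y} = ⊤) : FiniteDimensional F L := by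
  obtain ⟨c, hc⟩ := hy
  have hyint : IsIntegral F y :=
    IsIntegral.of_pow hp.pos (by rw [← hc]; exact isIntegral_algebraMap)
  haveI := IntermediateField.adjoin.finiteDimensional hyint
  exact ((IntermediateField.equivOfEq hytop).trans
    IntermediateField.topEquiv).toLinearEquiv.finiteDimensional

/-- **Over a perfect field `K` of characteristic `p`, the torsor crux at `p` implies `RRLU1_K`**
(Temkin 2013, Rem. 1.3.5 (i)–(ii), with the regular chart given). Let `hT` be local
uniformization of `α_p`-torsors over bases regular at the centre, relative form, for every
ground field of characteristic `p` (route `Valuative`'s `LuAlphaPTorsor` at `p`). Then for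
`K ⊆ F ⊆ L` with `F/K` finitely generated, `L = F(y)` with `y ^ p ∈ F`, a finitely generated
regular `K`-subalgebra `B ⊆ L` with `Frac B = L`, and a valuation ring `O ⊇ B` of `L`, the
valuation ring `O ∩ F` of `F` is locally uniformizable over `K`: push `B` down by the Frobenius
`ρ : L → F` (exponent of `L/F`) to `ρ(B) ⊆ O ∩ F`, regular at the centre and generating `F^{pⁿ}`
over `K^{pⁿ} = K`, then climb back to `F` by finitely many `p`-th roots inside `O ∩ F`, one
application of the crux each. [cite: Temkin2013, Rem. 1.3.5 (i)–(ii)] -/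
theorem rrLU1At_of_luAlphaPTorsorAt (p : ℕ) (hp : p.Prime) (K : Type) [Field K] [CharP K p]
    [PerfectField K]
    (hT : ∀ (k M : Type) [Field k] [CharP k p] [Field M] [Algebra k M] (O : ValuationSubring M)
      (A₀ : Subalgebra k M) (h₀ : A₀.toSubring ≤ O.toSubring) (t : M), A₀.FG → t ^ p ∈ A₀ →
      IsFractionRing (Algebra.adjoin k (insert t (A₀ : Set M))) M →
      IsRegularLocalRing (Localization.AtPrime
        (Ideal.comap (Subring.inclusion h₀) (maximalIdeal O))) →
      ∃ (A : Subalgebra k M) (h : A.toSubring ≤ O.toSubring), A₀ ≤ A ∧ t ∈ A ∧ A.FG ∧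
        IsFractionRing A M ∧
        IsRegularLocalRing (Localization.AtPrime
          (Ideal.comap (Subring.inclusion h) (maximalIdeal O)))) :
    ∀ (F L : Type) [Field F] [Field L] [Algebra K F] [Algebra F L] [Algebra K L]
      [IsScalarTower K F L], (⊤ : IntermediateField K F).FG → IsPurelyInseparable F L →
      (∃ y : L, y ^ p ∈ (algebraMap F L).range ∧ IntermediateField.adjoin F {y} = ⊤) →
      ∀ B : Subalgebra K L, B.FG → IsFractionRing B L → IsRegularRing B →
      ∀ O : ValuationSubring L, B.toSubring ≤ O.toSubring →
        IsLocallyUniformizable K F (O.comap (algebraMap F L)) := by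
  intro F L _ _ _ _ _ _ hFfg _hpi hy B hBfg hBfr hBreg O hBO
  classical
  haveI : Fact p.Prime := ⟨hp⟩
  haveI : CharP F p := (Algebra.charP_iff K F p).mp inferInstance
  -- `L/F` is finite, hence has an exponent `n`; `ρ x = x^{pⁿ} : L → F`
  obtain ⟨y, hy, hytop⟩ := hy
  haveI : FiniteDimensional F L := finiteDimensional_of_adjoin_pth_root_eq_top hp hy hytop
  set n : ℕ := IsPurelyInseparable.exponent F L with hn
  set ρ : L →+* F := IsPurelyInseparable.iterateFrobenius F L p (le_refl n) with hρ
  set Kpn : Subfield F := ((algebraMap K F).comp (iterateFrobenius K p n)).fieldRange with hKpn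
  haveI : CharP Kpn p := (Algebra.charP_iff Kpn F p).mpr inferInstance
  -- the valuation ring downstairs and `O = ρ⁻¹ (O ∩ F)`
  set OF : ValuationSubring F := O.comap (algebraMap F L) with hOF
  have hKO : ∀ c : K, algebraMap K F c ∈ OF := fun c => by
    change algebraMap F L (algebraMap K F c) ∈ O
    rw [← IsScalarTower.algebraMap_apply]
    exact hBO (B.algebraMap_mem c)
  have hOeq : OF.comap ρ = O := comap_iterateFrobenius_eq p (le_refl n) OF O rfl
  have hN : B.toSubring ≤ (OF.comap ρ).toSubring := by
    rw [hOeq]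
    exact hBO
  -- Frobenius transport of the chart `B`: `A₀ = ρ(B)`, a `K^{pⁿ}`-chart of `O ∩ F`
  obtain ⟨A₀, hA₀, hA₀fg⟩ := exists_subalgebra_frobeniusBaseField (le_refl n) B hBfg
  have hA₀' : B.toSubring.map ρ = A₀.toSubring := hA₀.symm
  have h₀ : A₀.toSubring ≤ OF.toSubring := by
    rw [← hA₀']
    exact map_iterateFrobenius_le p (le_refl n) OF B.toSubring hN
  have hBreg' : IsRegularLocalRing (Localization.AtPrime
      (Ideal.comap (Subring.inclusion hN) (maximalIdeal ↥(OF.comap ρ)))) :=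
    IsRegularRing.isRegularLocalRing_localization (R := B) _
  have hreg₀ : IsRegularLocalRing (Localization.AtPrime
      (Ideal.comap (Subring.inclusion h₀) (maximalIdeal OF))) :=
    (isRegularLocalRing_centre_map_iterateFrobenius p (le_refl n) OF B.toSubring hN A₀.toSubring
      hA₀' h₀).mp hBreg'
  have hBfr' : ∀ z : L, ∃ a ∈ B.toSubring, ∃ b ∈ B.toSubring, z = a / b := fun z => by
    obtain ⟨a, b, -, rfl⟩ := IsFractionRing.div_surjective (A := B) z
    exact ⟨a, a.2, b, b.2, rfl⟩
  have hKp : ∀ x : F, x ^ p ^ n ∈ IntermediateField.adjoin Kpn (A₀ : Set F) :=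
    pow_mem_adjoin_of_isFractionRing (le_refl n) B.toSubring hBfr' A₀ hA₀
  -- finitely many generators of `F` over `K^{pⁿ}` inside `O ∩ F` (`K` perfect is `F`-finite)
  obtain ⟨G, hGO, hGtop⟩ := exists_finset_generators_over_frobeniusBaseField K F p
    (moduleFinite_frobeniusRange_of_perfectField K p) hFfg OF hKO n
  -- climb the `p`-radical tower with the crux
  obtain ⟨A₁, h₁, hle₁, hfg₁, hreg₁, hadj₁⟩ :=
    torsor_roots hT OF n G A₀ h₀ hA₀fg hreg₀ hGO (fun g _ => hKp g)
  have htop : IntermediateField.adjoin Kpn (A₁ : Set F) = ⊤ :=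
    hGtop _ (by
      rw [hadj₁]
      exact fun g hg => IntermediateField.subset_adjoin Kpn _ (Or.inr hg))
  haveI hA₁fr : IsFractionRing A₁.toSubring F := by
    refine IsFractionRing.of_field A₁.toSubring F fun z => ?_
    have hz : z ∈ IntermediateField.adjoin Kpn (A₁ : Set F) := by
      rw [htop]; exact IntermediateField.mem_top
    obtain ⟨r, hr, s, hs, rfl⟩ := IntermediateField.mem_adjoin_iff_div.mp hz
    rw [Algebra.adjoin_eq] at hr hs
    exact ⟨⟨r, hr⟩, ⟨s, hs⟩, rfl⟩
  -- the `K`-chart `A := K[A₁]` (absorption; over a perfect `K` this is `A₁` itself)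
  obtain ⟨S₁, hS₁⟩ := hfg₁
  let A : Subalgebra K F := Algebra.adjoin K ((S₁ : Finset F) : Set F)
  have hS₁A₁ : (S₁ : Set F) ⊆ A₁ := by rw [← hS₁]; exact Algebra.subset_adjoin
  have hA₁A : A₁.toSubring ≤ A.toSubring := by
    rw [← hS₁, Algebra.adjoin_eq_ring_closure, Subring.closure_le]
    rintro x (⟨c, rfl⟩ | hx)
    · obtain ⟨a, ha⟩ := frobeniusBaseField_le_range c.2
      change (c : F) ∈ A
      rw [← ha]
      exact A.algebraMap_mem a
    · exact Algebra.subset_adjoin hx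
  let Oalg : Subalgebra K F := { OF.toSubring with algebraMap_mem' := hKO }
  have hAO : A.toSubring ≤ OF.toSubring := by
    have hle : A ≤ Oalg := Algebra.adjoin_le fun x hx => h₁ (hS₁A₁ hx)
    exact fun x hx => hle hx
  have hpow : ∀ x ∈ A.toSubring, x ^ p ^ n ∈ A₁.toSubring := by
    let C : Subalgebra K F :=
      { A₁.toSubring.comap (iterateFrobenius F p n) with
        algebraMap_mem' := fun c => by
          change iterateFrobenius F p n (algebraMap K F c) ∈ A₁.toSubring
          rw [iterateFrobenius_def]
          exact hle₁ (A₀.algebraMap_mem ⟨_, algebraMap_pow_mem_frobeniusBaseField c⟩) }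
    have hAC : A ≤ C := Algebra.adjoin_le (by
      intro x hx
      change iterateFrobenius F p n x ∈ A₁.toSubring
      rw [iterateFrobenius_def]
      exact pow_mem (hS₁A₁ hx) _)
    intro x hx
    have := hAC hx
    change iterateFrobenius F p n x ∈ A₁.toSubring at this
    rwa [iterateFrobenius_def] at this
  have hregA := isRegularLocalRing_centre_of_pow_mem OF A₁.toSubring A.toSubring hA₁A h₁ hAO
    (pow_pos hp.pos n) hpow hreg₁
  refine ⟨A, hAO, ⟨_, rfl⟩, ?_, hregA⟩
  refine IsFractionRing.of_field A F fun z => ?_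
  obtain ⟨a, b, -, rfl⟩ := IsFractionRing.div_surjective (A := A₁.toSubring) z
  exact ⟨⟨a, hA₁A a.2⟩, ⟨b, hA₁A b.2⟩, rfl⟩

/-- **Route `Valuative`'s crux `LuAlphaPTorsor` (stmt-ResolutionOfSingularities-0641) BY NAME
implies `RRLU1_K` over every perfect field `K` of every prime characteristic `p`.**
[cite: Temkin2013, Rem. 1.3.5 (i)–(ii)] -/
theorem rrLU1At_of_luAlphaPTorsor
    (hLu : Summit.ResolutionOfSingularities.ResolutionOfSingularities.Theses.Valuative.LuAlphaPTorsor)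
    (p : ℕ) (hp : p.Prime) (K : Type) [Field K] [CharP K p] [PerfectField K] :
    ∀ (F L : Type) [Field F] [Field L] [Algebra K F] [Algebra F L] [Algebra K L]
      [IsScalarTower K F L], (⊤ : IntermediateField K F).FG → IsPurelyInseparable F L →
      (∃ y : L, y ^ p ∈ (algebraMap F L).range ∧ IntermediateField.adjoin F {y} = ⊤) →
      ∀ B : Subalgebra K L, B.FG → IsFractionRing B L → IsRegularRing B →
      ∀ O : ValuationSubring L, B.toSubring ≤ O.toSubring →
        IsLocallyUniformizable K F (O.comap (algebraMap F L)) :=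
  rrLU1At_of_luAlphaPTorsorAt p hp K (hLu p hp)

/-- **Hence the rev. c4 core of `RRLU1_K`** (the line's registered research residue
`stub_rrLU1Perfect_core`: zero-dimensional valuation rings whose trace is not an Abhyankar
place) **follows from `LuAlphaPTorsor` by name** — the extra hypotheses are simply dropped.
[cite: Temkin2013, Rem. 1.3.5 (i)–(ii)] -/
theorem rrLU1CoreAt_of_luAlphaPTorsor
    (hLu : Summit.ResolutionOfSingularities.ResolutionOfSingularities.Theses.Valuative.LuAlphaPTorsor)
    (p : ℕ) (hp : p.Prime) (K : Type) [Field K] [CharP K p] [PerfectField K] :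
    ∀ (F L : Type) [Field F] [Field L] [Algebra K F] [Algebra F L] [Algebra K L]
      [IsScalarTower K F L], (⊤ : IntermediateField K F).FG → IsPurelyInseparable F L →
      (∃ y : L, y ^ p ∈ (algebraMap F L).range ∧ IntermediateField.adjoin F {y} = ⊤) →
      ∀ B : Subalgebra K L, B.FG → IsFractionRing B L → IsRegularRing B →
      ∀ O : ValuationSubring L, B.toSubring ≤ O.toSubring →
        (∀ x ∈ O, ∃ f : Polynomial K, f ≠ 0 ∧ Polynomial.aeval x f ∈ O.nonunits) →
        (∀ x ∈ O.comap (algebraMap F L), ∃ f : Polynomial K, f ≠ 0 ∧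
          Polynomial.aeval x f ∈ (O.comap (algebraMap F L)).nonunits) →
        ¬ IsAbhyankarPlace (O.comap (algebraMap F L)) (algebraMap K F).fieldRange ⊤ →
        IsLocallyUniformizable K F (O.comap (algebraMap F L)) :=
  fun F L _ _ _ _ _ _ hfg hpi hy B hBfg hBfr hBreg O hBO _ _ _ =>
    rrLU1At_of_luAlphaPTorsor hLu p hp K F L hfg hpi hy B hBfg hBfr hBreg O hBO

end Summit.ResolutionOfSingularities.ResolutionOfSingularities.Theorems.PalterationThesis.PerfectAtoms

end
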